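import Literature.MathematicalPhysics.QuantumFieldTheory.Balaban1983to89.B6MultiLevelTorusMirrorDecay

/-!
# `Balaban1983to89.B6MultiLevelTorusMirrorMajorant` — [Balaban1984PropagatorsII] (2.51)∕(2.67) p. 232–234: EVERY BLOCK MAJORANT OF THE TORUS GREEN's FUNCTION OF THE
# REFLECTED FAMILY FOLDS TO A BLOCK MAJORANT OF THE DIRICHLET GREEN's FUNCTION ([Balaban1985BackgroundPropagators] p. 394 «Ω₀Δ′_aΩ₀ … G′»), weights and constants free

FRAMING (verbatim cell line):
statement-level skeleton of published theorems with citation tags; proofs where landed; nothing here is a claim about the Yang–Mills mass gap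

Sources: T. Bałaban, *Propagators and renormalization transformations for lattice gauge theories. II*, Commun. Math. Phys. **96** (1984) 223–250
[`Balaban1984PropagatorsII`], (2.51) p. 232 («|(Tλ)(x)| ≤ K(y, y′)|λ|, x ∈ B^j(y), supp λ ⊂ B^{j′}(y′)»), Prop. 2.2 (2.67) p. 234; T. Bałaban, *Propagators for lattice
gauge theories in a background field*, Commun. Math. Phys. **99** (1985) 389–434 [`Balaban1985BackgroundPropagators`], p. 394 (the Dirichlet operator `Ω₀Δ′_aΩ₀` and
its inverse `G′`), p. 409 l. 1–5 («G′_□(U) … satisfy all the inequalities of Theorems 3.1–3.3»); T. Bałaban, *Regularity and decay of lattice Green's functions*,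
Commun. Math. Phys. **89** (1983) 571–597 [`Balaban1983RegularityDecay`], (2.42) p. 584 (the method of images).  Unit `pub-ymgap-dag-n06-c` (g31), file D3d′ of
ROAD (I) «IMAGES» (after D3d `B6MultiLevelTorusMirrorDecay`, which is the instance at p33's census weights `a_{j+1}`).

## WHAT THIS FILE CERTIFIES (kernel-checked; `η = 1`, `L = ℓ + 1`)

For a `…L0` family `F` on the torus `N₀ = N0 L M_h k P`, a mirror datum `(k′, mir, m, g)` under the standing binders (FIT `hfit`, MARGIN `hmarg`), ANY positive
weights `a`, the reflected family `F′ = reflected F …` on the doubled torus `N′` and the open mirror box `X` (`Ω₀ = emb X`):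
* `blkOf_eq_iff_blkOf_emb_eq` — on the closed box, two sites lie in one block of `F′` iff their embedded images lie in one block of `F`;
  `blkPsi_blkOf_of_mem_closed` — the transfer map `Ψ` of D3d sends the `F′`-block of a closed-box site to the `F`-block of its image;
* ★★★ `dirichlet_hasMajorant` — **IF the torus Green's function `G′[F′] = gmlT N′ L k′ lev′ a` has a block majorant `φ(j(y))·e^{−δ d_{F′}(y, y′)}` in the sense of
  `B6RandomWalk.HasMajorant` (p33's (2.51) shape; `φ ≥ 0` a function of the LEVEL of the target block, `δ ≥ 0`), THEN the Dirichlet Green's function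
  `(Ω₀Δ′_a[F]Ω₀)⁻¹` (unknowns indexed by `X`, blocks read through `emb` in `F`'s geometry `geomT F`) has the block majorant `#(mirIdx mir)·φ(j(y))·e^{−δ d_F(y, y′)}`** —
  the solution formula `inv_compress_emb_mulVec` (D3b), the hypothesis once per image `λ_ε = f̃ ∘ σ_ε⁻¹` (supported in the image block, same bound), `|(−1)^{#ε}| ≤ 1`,
  and the folding `d_F(Ψ s, Ψ s′) ≤ d_{F′}(s, σ_ε s′)` (D3d `dist_blkPsi_le_dist_trefl`).
  Use: with `B6Prop22MultiLevelTorusL0.prop22_first_multiLevelTorus` at `(F′, a, c)` for window weights (e.g. r05's `wCube`, `cCube` of the cube letters) this is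
  (2.67)₁ ∕ (3.42)₁ at `U = 1` for print's Dirichlet cube letter `G′_□(1)` with the constant `2^{d+1}·C(d, L)` (file D3c).

## HONEST SCOPE

Exact algebra and bookkeeping over D1–D3d; the weights, the majorant profile `φ` and the rate `δ` are binders (no estimate is produced here, one is TRANSPORTED).
Nothing continuum ∕ OS ∕ Clay; N06 is not discharged by this file; the YM mass gap is not proved by any of this.
-/

namespace Literature.MathematicalPhysics.QuantumFieldTheory.Balaban1983to89.B6MultiLevelTorusMirrorMajorant

noncomputable section

open Finset Matrix
open Literature.MathematicalPhysics.QuantumFieldTheory.Balaban1983to89.B4Reflection242 (boxDom mem_boxDom blk)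
open Literature.MathematicalPhysics.QuantumFieldTheory.Balaban1983to89.B6MultiLevelBoxOperator (N0 bigSide one_le_bigSide)
open Literature.MathematicalPhysics.QuantumFieldTheory.Balaban1983to89.B6MultiLevelTorusOperator (twrap tshift mlOpT gmlT one_le_of_mem one_le_N0)
open Literature.MathematicalPhysics.QuantumFieldTheory.Balaban1983to89.B6MultiLevelTorusOperatorL0 (TDomains)
open Literature.MathematicalPhysics.QuantumFieldTheory.Balaban1983to89.B6Geom246MultiLevelBoxL0 (bset blkOf blkOf_val exists_blkOf_eq blkOf_eq_iff_blk lev_eq_of_blkOf_eq)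
open Literature.MathematicalPhysics.QuantumFieldTheory.Balaban1983to89.B6Geom246MultiLevelTorusL0 (TouchT bondT bondT_adj connectedT geomT)
open Literature.MathematicalPhysics.QuantumFieldTheory.Balaban1983to89.B6RandomWalk (HasMajorant BlockSupp)
open Literature.MathematicalPhysics.QuantumFieldTheory.Balaban1983to89.B4Eq242TorusMirrors
open Literature.MathematicalPhysics.QuantumFieldTheory.Balaban1983to89.B6MultiLevelTorusMirrorL0
open Literature.MathematicalPhysics.QuantumFieldTheory.Balaban1983to89.B6MultiLevelTorusMirrorDirichlet
open Literature.MathematicalPhysics.QuantumFieldTheory.Balaban1983to89.B6MultiLevelTorusMirrorCompression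
open Literature.MathematicalPhysics.QuantumFieldTheory.Balaban1983to89.B6MultiLevelTorusMirrorDecay
open Literature.MathematicalPhysics.QuantumFieldTheory.Balaban1983to89.B4Eq242SignedImages (signedImK)

variable {d : ℕ}

section

variable {ℓ Mh k R : ℕ} {P : Fin (d + 1) → ℕ} {k' : ℕ} {mir : Fin (d + 1) → Bool} {m : Fin (d + 1) → ℕ} {g : Fin (d + 1) → ℤ}
variable {F : TDomains d ℓ Mh k P R} {hL : Odd (ℓ + 1)} {hM : Odd Mh} {hMh : 1 ≤ Mh} {hP : ∀ μ, 1 ≤ P μ} {hk : k' ≤ k} {hlev : ∀ x, F.lev x ≤ k'}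
  {hm : ∀ μ, mir μ = true → 2 ≤ m μ} {hg : ∀ μ, sTop ℓ Mh k' ∣ g μ}

/-- ★ ON THE CLOSED MIRROR BOX, TWO SITES LIE IN ONE BLOCK OF THE REFLECTED FAMILY IFF THEIR EMBEDDED IMAGES LIE IN ONE BLOCK OF THE ORIGINAL ONE (levels agree by
`levR_of_mem_closed`, labels by D3b `blk_eq_iff_blk_emb_eq`). [cite: Balaban1984PropagatorsII, (2.1) p.224, (2.45) p.231, bookkeeping] -/
theorem blkOf_eq_iff_blkOf_emb_eq (hfit : ∀ μ, mir μ = true → nMir ℓ Mh k' m μ + sTop ℓ Mh k' ≤ (N0 ℓ Mh k P μ : ℤ))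
    {y y' : ↥(boxDom (N0 ℓ Mh k' (Pref ℓ k k' P mir m)))}
    (hy : y ∈ mirBoxClosed (N0 ℓ Mh k' (Pref ℓ k k' P mir m)) mir (nMir ℓ Mh k' m) (fun _ => hMir ℓ Mh k'))
    (hy' : y' ∈ mirBoxClosed (N0 ℓ Mh k' (Pref ℓ k k' P mir m)) mir (nMir ℓ Mh k' m) (fun _ => hMir ℓ Mh k')) :
    blkOf (reflected F k' mir m g hL hM hMh hP hk hlev hm hg).toDomains y = blkOf (reflected F k' mir m g hL hM hMh hP hk hlev hm hg).toDomains y' ↔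
      blkOf F.toDomains ⟨B6MultiLevelTorusMirrorL0.emb (ℓ := ℓ) (Mh := Mh) (k := k) (P := P) g y.1, emb_mem hMh hP g y.1⟩ =
        blkOf F.toDomains ⟨B6MultiLevelTorusMirrorL0.emb (ℓ := ℓ) (Mh := Mh) (k := k) (P := P) g y'.1, emb_mem hMh hP g y'.1⟩ := by
  have hly : (reflected F k' mir m g hL hM hMh hP hk hlev hm hg).lev y.1 = F.lev (B6MultiLevelTorusMirrorL0.emb (ℓ := ℓ) (Mh := Mh) (k := k) (P := P) g y.1) := by
    rw [reflected_lev]; exact levR_of_mem_closed hy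
  have hly' : (reflected F k' mir m g hL hM hMh hP hk hlev hm hg).lev y'.1 = F.lev (B6MultiLevelTorusMirrorL0.emb (ℓ := ℓ) (Mh := Mh) (k := k) (P := P) g y'.1) := by
    rw [reflected_lev]; exact levR_of_mem_closed hy'
  have hj : F.lev (B6MultiLevelTorusMirrorL0.emb (ℓ := ℓ) (Mh := Mh) (k := k) (P := P) g y.1) ≤ k' + 1 := le_trans (hlev _) (Nat.le_succ _)
  have key := blk_eq_iff_blk_emb_eq hL hM hMh hP hk hm hg hfit hj hy hy'
  constructor
  · intro h
    have hl := congrArg (fun s => s.1.1) h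
    have hb := congrArg (fun s => s.1.2) h
    simp only [blkOf_val, TDomains.toDomains_lev] at hl hb
    apply Subtype.ext
    simp only [blkOf_val, TDomains.toDomains_lev]
    rw [← hl] at hb
    rw [hly] at hb
    rw [← hly, ← hly', ← hl, hly, key.1 hb]
  · intro h
    have hl := congrArg (fun s => s.1.1) h
    have hb := congrArg (fun s => s.1.2) h
    simp only [blkOf_val, TDomains.toDomains_lev] at hl hb
    apply Subtype.ext
    simp only [blkOf_val, TDomains.toDomains_lev]
    rw [← hl] at hb
    rw [hly, hly', ← hl, key.2 hb]

/-- the transfer map `Ψ` at the block of a CLOSED-box site is the `F`-block of its embedded image (`fold = id` there).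
[cite: Balaban1984PropagatorsII, (2.45) p.231; Balaban1983RegularityDecay, (2.42) p.584, bookkeeping] -/
theorem blkPsi_blkOf_of_mem_closed {y : ↥(boxDom (N0 ℓ Mh k' (Pref ℓ k k' P mir m)))}
    (hy : y ∈ mirBoxClosed (N0 ℓ Mh k' (Pref ℓ k k' P mir m)) mir (nMir ℓ Mh k' m) (fun _ => hMir ℓ Mh k')) :
    blkPsi F k' mir m g hL hM hMh hP hk hlev hm hg (blkOf (reflected F k' mir m g hL hM hMh hP hk hlev hm hg).toDomains y) =
      blkOf F.toDomains ⟨B6MultiLevelTorusMirrorL0.emb (ℓ := ℓ) (Mh := Mh) (k := k) (P := P) g y.1, emb_mem hMh hP g y.1⟩ := by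
  rw [blkPsi_eq_of_blkOf rfl]
  congr 1
  apply Subtype.ext
  rw [embPt_val, tfold_of_mem_closed _ hy]

/-- ★★★ **EVERY BLOCK MAJORANT OF THE TORUS GREEN's FUNCTION OF THE REFLECTED FAMILY FOLDS TO ONE OF THE DIRICHLET GREEN's FUNCTION** (`2^{#mir}` images, distance folded by
`Ψ`): if `G′[F′]` has the majorant `φ(j(y))·e^{−δ d_{F′}(y,y′)}` (`φ ≥ 0`, `δ ≥ 0`), then `(Ω₀Δ′_a[F]Ω₀)⁻¹` — unknowns on the open box `X`, blocks of `F` read through `emb` —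
has the majorant `#(mirIdx mir)·φ(j(y))·e^{−δ d_F(y,y′)}`.
[cite: Balaban1984PropagatorsII, (2.51) p.232, Prop. 2.2 (2.67) p.234; Balaban1985BackgroundPropagators, p.394, p.409 l.1–5; Balaban1983RegularityDecay, (2.42) p.584] -/
theorem dirichlet_hasMajorant
    (hfit : ∀ μ, mir μ = true → nMir ℓ Mh k' m μ + sTop ℓ Mh k' ≤ (N0 ℓ Mh k P μ : ℤ)) (a : ℕ → ℝ) (ha : ∀ j, 0 < a j)
    (hmarg : ∀ x : ↥(boxDom (N0 ℓ Mh k' (Pref ℓ k k' P mir m))),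
      x ∈ mirBoxOpen (N0 ℓ Mh k' (Pref ℓ k k' P mir m)) mir (nMir ℓ Mh k' m) (fun _ => hMir ℓ Mh k') →
      ∀ z : ↥(boxDom (N0 ℓ Mh k' (Pref ℓ k k' P mir m))),
        blk ((ℓ + 1) ^ (reflected F k' mir m g hL hM hMh hP hk hlev hm hg).lev x.1) z.1 = blk ((ℓ + 1) ^ (reflected F k' mir m g hL hM hMh hP hk hlev hm hg).lev x.1) x.1 →
        z ∈ mirBoxOpen (N0 ℓ Mh k' (Pref ℓ k k' P mir m)) mir (nMir ℓ Mh k' m) (fun _ => hMir ℓ Mh k'))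
    {φ : ℕ → ℝ} (hφ : ∀ j, 0 ≤ φ j) {δ : ℝ} (hδ : 0 ≤ δ)
    (hK : HasMajorant (g := geomT (reflected F k' mir m g hL hM hMh hP hk hlev hm hg)) (blkOf (reflected F k' mir m g hL hM hMh hP hk hlev hm hg).toDomains)
      (Matrix.toLin' (gmlT (N0 ℓ Mh k' (Pref ℓ k k' P mir m)) ℓ k' (reflected F k' mir m g hL hM hMh hP hk hlev hm hg).lev a))
      (fun y y' => φ y.1.1 * Real.exp (-(δ * (geomT (reflected F k' mir m g hL hM hMh hP hk hlev hm hg)).dist y y')))) :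
    HasMajorant (g := geomT F)
      (fun x : ↥(mirBoxOpen (N0 ℓ Mh k' (Pref ℓ k k' P mir m)) mir (nMir ℓ Mh k' m) (fun _ => hMir ℓ Mh k')) =>
        blkOf F.toDomains ⟨B6MultiLevelTorusMirrorL0.emb (ℓ := ℓ) (Mh := Mh) (k := k) (P := P) g x.1.1, emb_mem hMh hP g x.1.1⟩)
      (Matrix.toLin' ((mlOpT (N0 ℓ Mh k P) ℓ k F.lev a).submatrix
        (fun v : ↥(mirBoxOpen (N0 ℓ Mh k' (Pref ℓ k k' P mir m)) mir (nMir ℓ Mh k' m) (fun _ => hMir ℓ Mh k')) => (⟨B6MultiLevelTorusMirrorL0.emb (ℓ := ℓ) (Mh := Mh) (k := k) (P := P) g v.1.1, emb_mem hMh hP g v.1.1⟩ : ↥(boxDom (N0 ℓ Mh k P))))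
        (fun v : ↥(mirBoxOpen (N0 ℓ Mh k' (Pref ℓ k k' P mir m)) mir (nMir ℓ Mh k' m) (fun _ => hMir ℓ Mh k')) => (⟨B6MultiLevelTorusMirrorL0.emb (ℓ := ℓ) (Mh := Mh) (k := k) (P := P) g v.1.1, emb_mem hMh hP g v.1.1⟩ : ↥(boxDom (N0 ℓ Mh k P)))))⁻¹)
      (fun y y' => (mirIdx mir).card * φ y.1.1 * Real.exp (-(δ * (geomT F).dist y y'))) := by
  classical
  intro y' μ B hμ x
  -- the trivial datum
  by_cases h0 : μ = 0
  · subst h0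
    rw [map_zero, Pi.zero_apply, abs_zero]
    exact mul_nonneg (mul_nonneg (mul_nonneg (Nat.cast_nonneg _) (hφ _)) (Real.exp_nonneg _)) hμ.nonneg
  obtain ⟨x₀, hx₀⟩ : ∃ x₀, μ x₀ ≠ 0 := by
    by_contra hall
    exact h0 (funext fun z => by simpa using (not_exists.1 hall) z)
  -- the source block, read in `F` and in `F′`
  have hy' : blkOf F.toDomains ⟨B6MultiLevelTorusMirrorL0.emb (ℓ := ℓ) (Mh := Mh) (k := k) (P := P) g x₀.1.1, emb_mem hMh hP g x₀.1.1⟩ = y' := by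
    by_contra hne; exact hx₀ (hμ.off x₀ hne)
  set s' := blkOf (reflected F k' mir m g hL hM hMh hP hk hlev hm hg).toDomains x₀.1 with hs'
  have hsupp : ∀ y : ↥(mirBoxOpen (N0 ℓ Mh k' (Pref ℓ k k' P mir m)) mir (nMir ℓ Mh k' m) (fun _ => hMir ℓ Mh k')), μ y ≠ 0 →
      blkOf (reflected F k' mir m g hL hM hMh hP hk hlev hm hg).toDomains y.1 = s' := by
    intro y hy
    have hb : blkOf F.toDomains ⟨B6MultiLevelTorusMirrorL0.emb (ℓ := ℓ) (Mh := Mh) (k := k) (P := P) g y.1.1, emb_mem hMh hP g y.1.1⟩ = y' := by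
      by_contra hne; exact hy (hμ.off y hne)
    rw [hs']
    exact (blkOf_eq_iff_blkOf_emb_eq (hL := hL) (hM := hM) (hMh := hMh) (hP := hP) (hk := hk) (hlev := hlev) (hm := hm) (hg := hg) hfit
      (mirBoxOpen_subset_closed y.2) (mirBoxOpen_subset_closed x₀.2)).2 (hb.trans hy'.symm)
  have hμle : ∀ y, |μ y| ≤ B := by
    intro y
    by_cases hb : blkOf F.toDomains ⟨B6MultiLevelTorusMirrorL0.emb (ℓ := ℓ) (Mh := Mh) (k := k) (P := P) g y.1.1, emb_mem hMh hP g y.1.1⟩ = y'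
    · exact hμ.bound y hb
    · rw [hμ.off y hb, abs_zero]; exact hμ.nonneg
  -- the solution formula
  rw [Matrix.toLin'_apply, inv_compress_emb_mulVec (hL := hL) (hM := hM) (hMh := hMh) (hP := hP) (hk := hk) (hlev := hlev) (hm := hm) (hg := hg) hfit a ha hmarg μ x]
  set G' := gmlT (N0 ℓ Mh k' (Pref ℓ k k' P mir m)) ℓ k' (reflected F k' mir m g hL hM hMh hP hk hlev hm hg).lev a with hG'
  -- the extension by zero and the image data
  set ft : ↥(boxDom (N0 ℓ Mh k' (Pref ℓ k k' P mir m))) → ℝ := fun w => ∑ y : ↥(mirBoxOpen (N0 ℓ Mh k' (Pref ℓ k k' P mir m)) mir (nMir ℓ Mh k' m) (fun _ => hMir ℓ Mh k')), if (y : ↥(boxDom (N0 ℓ Mh k' (Pref ℓ k k' P mir m)))) = w then μ y else 0 with hft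
  have hft_apply : ∀ w, ft w = if h : w ∈ mirBoxOpen (N0 ℓ Mh k' (Pref ℓ k k' P mir m)) mir (nMir ℓ Mh k' m) (fun _ => hMir ℓ Mh k') then μ ⟨w, h⟩ else 0 :=
    fun w => extZero_apply _ μ w
  have hft_abs : ∀ w, |ft w| ≤ B := by
    intro w; rw [hft_apply]; split_ifs with h
    · exact hμle ⟨w, h⟩
    · rw [abs_zero]; exact hμ.nonneg
  -- exchange the sums: `Σ_y (Σ_ε s_ε G′(x, σ_ε y)) μ y = Σ_ε s_ε (G′ λ_ε)(x)`, `λ_ε = ft ∘ σ_ε⁻¹`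
  have hswap : ∑ y : ↥(mirBoxOpen (N0 ℓ Mh k' (Pref ℓ k k' P mir m)) mir (nMir ℓ Mh k' m) (fun _ => hMir ℓ Mh k')), (∑ ε ∈ mirIdx mir, tsign ℝ mir ε * G' x.1 (trefl (hmir_of_top (k := k) (P := P) hL hM hMh hm) ε y.1)) * μ y =
      ∑ ε ∈ mirIdx mir, tsign ℝ mir ε * (G' *ᵥ (fun z => ft ((trefl (hmir_of_top (k := k) (P := P) hL hM hMh hm) ε).symm z))) x.1 := by
    have h1 : ∀ ε, (G' *ᵥ (fun z => ft ((trefl (hmir_of_top (k := k) (P := P) hL hM hMh hm) ε).symm z))) x.1 = ∑ y : ↥(mirBoxOpen (N0 ℓ Mh k' (Pref ℓ k k' P mir m)) mir (nMir ℓ Mh k' m) (fun _ => hMir ℓ Mh k')), G' x.1 (trefl (hmir_of_top (k := k) (P := P) hL hM hMh hm) ε y.1) * μ y := by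
      intro ε
      rw [Matrix.mulVec, dotProduct]
      rw [← Equiv.sum_comp (trefl (hmir_of_top (k := k) (P := P) hL hM hMh hm) ε) (fun z => G' x.1 z * ft ((trefl (hmir_of_top (k := k) (P := P) hL hM hMh hm) ε).symm z))]
      simp only [Equiv.symm_apply_apply]
      simp only [hft, Finset.mul_sum]
      rw [Finset.sum_comm]
      refine Finset.sum_congr rfl fun y _ => ?_
      rw [Finset.sum_eq_single y.1]
      · simp
      · intro w _ hw; rw [if_neg (fun e => hw e.symm)]; ring
      · intro hh; exact absurd (Finset.mem_univ _) hh
    simp_rw [h1, Finset.mul_sum, Finset.sum_mul]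
    rw [Finset.sum_comm]
    refine Finset.sum_congr rfl fun y _ => Finset.sum_congr rfl fun ε _ => ?_
    ring
  rw [hswap]
  -- the target block, read in `F′` and in `F`
  set s := blkOf (reflected F k' mir m g hL hM hMh hP hk hlev hm hg).toDomains x.1 with hs
  have hlev_eq : s.1.1 = (blkOf F.toDomains ⟨B6MultiLevelTorusMirrorL0.emb (ℓ := ℓ) (Mh := Mh) (k := k) (P := P) g x.1.1, emb_mem hMh hP g x.1.1⟩).1.1 := by
    rw [hs]
    simp only [blkOf_val, TDomains.toDomains_lev, reflected_lev]
    exact levR_of_mem_closed (mirBoxOpen_subset_closed x.2)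
  -- termwise bound
  have hterm : ∀ ε ∈ mirIdx mir, |tsign ℝ mir ε * (G' *ᵥ (fun z => ft ((trefl (hmir_of_top (k := k) (P := P) hL hM hMh hm) ε).symm z))) x.1| ≤
      φ (blkOf F.toDomains ⟨B6MultiLevelTorusMirrorL0.emb (ℓ := ℓ) (Mh := Mh) (k := k) (P := P) g x.1.1, emb_mem hMh hP g x.1.1⟩).1.1 *
        Real.exp (-(δ * (geomT F).dist (blkOf F.toDomains ⟨B6MultiLevelTorusMirrorL0.emb (ℓ := ℓ) (Mh := Mh) (k := k) (P := P) g x.1.1, emb_mem hMh hP g x.1.1⟩) y')) * B := by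
    intro ε _
    set lam : ↥(boxDom (N0 ℓ Mh k' (Pref ℓ k k' P mir m))) → ℝ := fun z => ft ((trefl (hmir_of_top (k := k) (P := P) hL hM hMh hm) ε).symm z) with hlam
    -- the image datum is supported in the image block `t = blkOf (σ_ε x₀)`
    set t : ↥(bset (reflected F k' mir m g hL hM hMh hP hk hlev hm hg).toDomains) := blkOf (reflected F k' mir m g hL hM hMh hP hk hlev hm hg).toDomains (trefl (hmir_of_top (k := k) (P := P) hL hM hMh hm) ε x₀.1) with ht
    have hbs : BlockSupp (g := geomT (reflected F k' mir m g hL hM hMh hP hk hlev hm hg)) (blkOf (reflected F k' mir m g hL hM hMh hP hk hlev hm hg).toDomains) lam t B := by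
      refine ⟨hμ.nonneg, fun z _ => hft_abs _, fun z hz => ?_⟩
      rw [hlam]
      simp only
      rw [hft_apply]
      split_ifs with hmem
      · by_contra hne
        have hb := hsupp ⟨_, hmem⟩ hne
        have e : z = trefl (hmir_of_top (k := k) (P := P) hL hM hMh hm) ε ((trefl (hmir_of_top (k := k) (P := P) hL hM hMh hm) ε).symm z) := ((trefl (hmir_of_top (k := k) (P := P) hL hM hMh hm) ε).apply_symm_apply z).symm
        apply hz
        rw [ht, e]
        exact blkOf_trefl_eq_of_blkOf_eq (F := F) (hL := hL) (hM := hM) (hMh := hMh) (hP := hP) (hk := hk) (hlev := hlev) (hm := hm) (hg := hg) ε (hb.trans hs')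
      · rfl
    -- the hypothesis at the reflected family
    have hc := hK t lam B hbs x.1
    rw [Matrix.toLin'_apply] at hc
    -- the folded distance: `d_F(blk(emb x), y′) = d_F(Ψ s, Ψ s′) ≤ d_{F′}(s, σ_ε s′) = d_{F′}(s, t)`
    have hd : (geomT F).dist (blkOf F.toDomains ⟨B6MultiLevelTorusMirrorL0.emb (ℓ := ℓ) (Mh := Mh) (k := k) (P := P) g x.1.1, emb_mem hMh hP g x.1.1⟩) y' ≤
        (geomT (reflected F k' mir m g hL hM hMh hP hk hlev hm hg)).dist s t := by
      have h1 := dist_blkPsi_le_dist_trefl (F := F) (hL := hL) (hM := hM) (hMh := hMh) (hP := hP) (hk := hk) (hlev := hlev) (hm := hm) (hg := hg) s ε x₀.1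
      rw [hs, blkPsi_blkOf_of_mem_closed (mirBoxOpen_subset_closed x.2), blkPsi_blkOf_of_mem_closed (mirBoxOpen_subset_closed x₀.2), hy'] at h1
      show ((bondT F).dist _ y' : ℝ) ≤ ((bondT (reflected F k' mir m g hL hM hMh hP hk hlev hm hg)).dist s t : ℝ)
      rw [hs]
      exact_mod_cast h1
    have hφs : 0 ≤ φ s.1.1 := hφ _
    rw [abs_mul]
    calc |tsign ℝ mir ε| * |(G' *ᵥ lam) x.1| ≤ 1 * (φ s.1.1 * Real.exp (-(δ * (geomT (reflected F k' mir m g hL hM hMh hP hk hlev hm hg)).dist s t)) * B) :=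
          mul_le_mul (abs_tsign_le ε) hc (abs_nonneg _) zero_le_one
      _ ≤ φ (blkOf F.toDomains ⟨B6MultiLevelTorusMirrorL0.emb (ℓ := ℓ) (Mh := Mh) (k := k) (P := P) g x.1.1, emb_mem hMh hP g x.1.1⟩).1.1 *
          Real.exp (-(δ * (geomT F).dist (blkOf F.toDomains ⟨B6MultiLevelTorusMirrorL0.emb (ℓ := ℓ) (Mh := Mh) (k := k) (P := P) g x.1.1, emb_mem hMh hP g x.1.1⟩) y')) * B := by
          rw [one_mul, ← hlev_eq]
          apply mul_le_mul_of_nonneg_right _ hμ.nonneg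
          apply mul_le_mul_of_nonneg_left _ hφs
          apply Real.exp_le_exp.2
          have : δ * (geomT F).dist (blkOf F.toDomains ⟨B6MultiLevelTorusMirrorL0.emb (ℓ := ℓ) (Mh := Mh) (k := k) (P := P) g x.1.1, emb_mem hMh hP g x.1.1⟩) y' ≤
              δ * (geomT (reflected F k' mir m g hL hM hMh hP hk hlev hm hg)).dist s t := mul_le_mul_of_nonneg_left hd hδ
          linarith
  calc |∑ ε ∈ mirIdx mir, tsign ℝ mir ε * (G' *ᵥ (fun z => ft ((trefl (hmir_of_top (k := k) (P := P) hL hM hMh hm) ε).symm z))) x.1|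
      ≤ ∑ ε ∈ mirIdx mir, |tsign ℝ mir ε * (G' *ᵥ (fun z => ft ((trefl (hmir_of_top (k := k) (P := P) hL hM hMh hm) ε).symm z))) x.1| := Finset.abs_sum_le_sum_abs _ _
    _ ≤ ∑ ε ∈ mirIdx mir, φ (blkOf F.toDomains ⟨B6MultiLevelTorusMirrorL0.emb (ℓ := ℓ) (Mh := Mh) (k := k) (P := P) g x.1.1, emb_mem hMh hP g x.1.1⟩).1.1 *
        Real.exp (-(δ * (geomT F).dist (blkOf F.toDomains ⟨B6MultiLevelTorusMirrorL0.emb (ℓ := ℓ) (Mh := Mh) (k := k) (P := P) g x.1.1, emb_mem hMh hP g x.1.1⟩) y')) * B :=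
        Finset.sum_le_sum hterm
    _ = (mirIdx mir).card * φ (blkOf F.toDomains ⟨B6MultiLevelTorusMirrorL0.emb (ℓ := ℓ) (Mh := Mh) (k := k) (P := P) g x.1.1, emb_mem hMh hP g x.1.1⟩).1.1 *
        Real.exp (-(δ * (geomT F).dist (blkOf F.toDomains ⟨B6MultiLevelTorusMirrorL0.emb (ℓ := ℓ) (Mh := Mh) (k := k) (P := P) g x.1.1, emb_mem hMh hP g x.1.1⟩) y')) * B := by
        rw [Finset.sum_const, nsmul_eq_mul]; ring

end

end

end Literature.MathematicalPhysics.QuantumFieldTheory.Balaban1983to89.B6MultiLevelTorusMirrorMajorant
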